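import Literature.Computability.MetaComplexity.UPSearchAssembly
import Literature.Computability.MetaComplexity.OneSidedHeuristicsProofs
import Literature.Computability.MetaComplexity.AvgCaseDerandomization
import HarnessLib

/-!
# Universal heuristic schemes (proofs): Hirahara's Lemma 2.2 (1) reduced to its §3–§5 leaves with BFP

Sibling proof file of `UniversalHeuristicSchemes.lean` for the named fact
`Hirahara2021_hasUHS_of_mem_UP` — Lemma 2.2 (1) of S. Hirahara, *Average-case hardness of NP from
exponential worst-case hardness assumptions* (STOC 2021; full version ECCC TR21-058, numbering cited):
*if `DistNP ⊆ AvgP`, then every language in `UP` admits a universal heuristic scheme*. The printed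
route (p. 12, p. 51: "Since `UP ⊆ NP_sv`, Item 1 of Theorem 1.6 is a special case of Theorem 11.1") is
`DistNP ⊆ AvgP ⟹ coNP × {U, T} ⊆ Avg¹_{1-n^{-c}} P` (p. 9; proved in `OneSidedHeuristicsProofs.lean`)
followed by Cor. 8.12 / Thm. 8.9 (a universal heuristic scheme for the search problem of every
`NP_sv`-type verifier), whose proof for `UP`-type verifiers is formalised in `UPSearchAssembly.lean`
(`UniversalMachine.hasSearchUHS_of_ingredients`) relative to the five results of §3–§5 it invokes:
Lemma 5.1, Thm. 4.2 (the tree's named facts `Hirahara2021_gapKvsK_mem_PromiseP`,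
`Hirahara2021_languageCompression`), Thm. 5.2 (weak symmetry of information, in its printed form — an
inline hypothesis and not a named fact since the D-0026 review of 2026-08-15, see
`UPSearchAssembly.lean`, "Size of what remains"), Lemma 3.4 in promise form (`pr-BPP = pr-P`) and
Thm. 3.12 in enumeration form.

The point of this file: Lemma 2.2 (1) carries the *strong* hypothesis `DistNP ⊆ AvgP`, under which
Lemma 3.4's role is played by the tree's named fact `BuhrmanFortnowPavan2004_PromiseBPP'_subset_PromiseP`
(Buhrman–Fortnow–Pavan 2005, Thm. 3.1: `DistNP ⊆ AvgP ⟹ Promise-BPP = Promise-P`,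
`AvgCaseDerandomization.lean`) instead of the paper's weak-hypothesis Lemma 3.4
(`coNP × {U, T} ⊆ Avg¹_{1-n^{-c}} P ⟹` a pseudorandom generator; BCGL92 + KS04 + BFP05 + IW97, p. 20),
which is not vendored. Accordingly the enumeration form of Thm. 3.12 ("in time `poly(ns2^k/δ)`, given
a description of the circuit `D`, one can enumerate a list of strings that contains `x`", p. 23) is
asked here only under `PromiseBPP' ⊆ PromiseP` — the decision derandomisation that a prefix search over
the randomised reconstruction of Lemma 3.14 consumes — rather than under the average-case hypothesis
(as in `Hirahara2021_UP_searchUHS_of_Avg1P_of`, whose `h312` is guarded by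
`coNP × {U, T} ⊆ Avg¹_{1-n^{-c}} P`). Hence:

* `Hirahara2021_hasUHS_of_mem_UP_of_BFP` — **Lemma 2.2 (1) from Lemma 5.1, Thm. 4.2, BFP Thm. 3.1
  (three named facts of the tree), Thm. 5.2 in its printed form and the enumeration form of Thm. 3.12
  under `PromiseBPP' ⊆ PromiseP`** (two explicit hypotheses). The discharge
  `Hirahara2021_hasUHS_of_mem_UP_holds` is this theorem fed the three `_holds` and proofs of `h52`, `h312`.

This is the `∀ U` (machine-by-machine) form of `Cryptography.hirahara_UP_DistNP_of_nonempty_of_BFP`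
(`Cryptography/AverageCaseProofs.lean`), stated at the level of Lemma 2.2 (1) rather than Thm. 1.6 (1).
No definition and no named fact is introduced here.

## References

* S. Hirahara, ECCC TR21-058 (2021): Lemma 2.2 (1) (p. 12), p. 9 (`AvgP ⊆ Avg¹_{1-n^{-c}} P`),
  Lemma 3.4 (p. 20), Thm. 3.12, the remark following it and Lemma 3.14 (p. 23), Thm. 4.2, Lemma 5.1,
  Thm. 5.2, Fact 8.4 (p. 37), Thm. 8.9 and Cor. 8.12 (pp. 40–42), Thm. 11.1 and p. 51.
* H. Buhrman, L. Fortnow, A. Pavan, *Some results on derandomization*, Theory Comput. Syst. 38 (2005),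
  Thm. 3.1.
-/

namespace Literature.Computability.MetaComplexity

open _root_.Computability Complexity Complexity.Classes Complexity.Nondeterministic Brick

/-- **Hirahara's Lemma 2.2 (1) from its §3–§5 leaves, with Buhrman–Fortnow–Pavan supplying the
derandomisation.** Assume Lemma 5.1 (`Hirahara2021_gapKvsK_mem_PromiseP`), Thm. 4.2
(`Hirahara2021_languageCompression`), Thm. 5.2 (weak symmetry of information) in its printed form
(`h52`: *if `coNP × {U, T} ⊆ Avg¹_{1-n^{-c}} P` for some `c`, then there exist polynomials `p₀, p_w`
such that for any `n, m`, any `t ≥ p₀(nm)`, any `ε > 0` and any `x ∈ {0,1}ⁿ`,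
`Pr_{w ← {0,1}^m}[K^t(xw) ≥ K^{p_w(t/ε)}(x) + m - log p_w(t/ε)] ≥ 1 - ε`*; `ε = 1/e`, `t/ε = t·e`,
`log = Nat.log 2`, in `ℕ∞` without subtraction, `∀ U`), BFP Thm. 3.1 in promise form
(`BuhrmanFortnowPavan2004_PromiseBPP'_subset_PromiseP`: `DistNP ⊆ AvgP ⟹ PromiseBPP' ⊆ PromiseP`) and
the enumeration form of Thm. 3.12 for polynomial-time tests with auxiliary input under
`PromiseBPP' ⊆ PromiseP` (`h312`: the remark printed after Thm. 3.12 for the circuits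
`w ↦ [⟨a, w⟩ ∈ D₀]`, `D₀ ∈ P`, inputs `dpEnumEnc a n k e = ⟨a, 1ⁿ, 1^{2^k}, 1ᵉ⟩`). Then
`Hirahara2021_hasUHS_of_mem_UP` holds: given `U`, `DistNP ⊆ AvgP` and `L ∈ UP` with `UP`-type
verifier `(R, p)`, first `coNP × {U, T} ⊆ Avg¹_{1-1/n} P`
(`distClass_coNP_subset_Avg1DeltaP_of_DistNP_subset_AvgP`, p. 9), which unlocks Lemma 5.1, Thm. 4.2
(applied to the `NP` ensemble `L'` of `DP_k`-encoded certificates, `upLang_mem_NP`) and Thm. 5.2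
(failure form); `PromiseBPP' ⊆ PromiseP` comes from BFP under `DistNP ⊆ AvgP` and feeds both Eq. (13)
and `h312`; the search scheme is `UniversalMachine.hasSearchUHS_of_ingredients` (the formalised proof
of Thm. 8.9) and the decision scheme is "a decision problem reduces to its search version"
(`IsSearchUHS.isUniversalHeuristicScheme`, proof of Cor. 8.12).
[Hirahara 2021 (ECCC TR21-058), Lemma 2.2 (1) via p. 9, Thm. 8.9, Cor. 8.12, Fact 8.4 and p. 51;
Buhrman–Fortnow–Pavan 2005, Thm. 3.1 in place of Lemma 3.4] [cite: Hirahara2021, Lemma 2.2 (1)] -/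
theorem Hirahara2021_hasUHS_of_mem_UP_of_BFP (h51 : Hirahara2021_gapKvsK_mem_PromiseP)
    (h42 : Hirahara2021_languageCompression)
    (h52 : ∀ U : UniversalMachine,
      (∃ c : ℕ, distClass coNP {uniformEnsemble, tallyEnsemble} ⊆
        Avg1DeltaP fun n => 1 - 1 / (n : ℝ) ^ c) →
      ∃ p₀ pw : Polynomial ℕ, ∀ (n m t e : ℕ) (x : List Bool), x.length = n → p₀.eval (n * m) ≤ t →
        1 ≤ e →
          1 - 1 / (e : ℝ) ≤ uniformProb m
            {w | U.ktAt (pw.eval (t * e)) x + m ≤ U.ktAt t (x ++ w) + Nat.log 2 (pw.eval (t * e))})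
    (hBFP : BuhrmanFortnowPavan2004_PromiseBPP'_subset_PromiseP)
    (h312 : PromiseBPP' ⊆ PromiseP →
      ∀ D₀ : Language Bool, D₀ ∈ P → ∃ E : List Bool → List Bool, E ∈ FP ∧
        ∀ (a x : List Bool) (k e : ℕ), 1 ≤ e →
          1 / (e : ℝ) ≤ dpAdvantage k x (fun w => D₀.boolIndicator (boolPair a w)) →
            x ∈ decNil (E (dpEnumEnc a x.length k e))) :
    Hirahara2021_hasUHS_of_mem_UP := by
  intro U hDist L hL
  -- p. 9 / §11: the strong hypothesis gives the weak one with `c = 1`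
  have hyp : ∃ c : ℕ, distClass coNP {uniformEnsemble, tallyEnsemble} ⊆
      Avg1DeltaP fun n => 1 - 1 / (n : ℝ) ^ c :=
    ⟨1, distClass_coNP_subset_Avg1DeltaP_of_DistNP_subset_AvgP hDist one_ne_zero⟩
  -- BFP: `pr-BPP = pr-P` under `DistNP ⊆ AvgP`
  have hBPP : PromiseBPP' ⊆ PromiseP := hBFP hDist
  -- the `UP`-type verifier of `L`
  obtain ⟨R, hR, p, hver, hsub⟩ := hL
  -- Lemma 5.1, Thm. 4.2 (for `L'`), Thm. 5.2 (failure form)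
  obtain ⟨τ, hτ⟩ := h51 U hyp
  obtain ⟨pc, hpc⟩ := h42 U hyp (U.upLang R p) (U.upLang_mem_NP hR p)
    (UniversalMachine.isLanguageEnsemble_upLang R p)
  obtain ⟨p₀, pw, hsoi⟩ := h52 U hyp
  -- Thm. 8.9 (search scheme), with BFP for Lemma 3.4 and `h312` for Thm. 3.12
  obtain ⟨S, C, hSC⟩ := U.hasSearchUHS_of_ingredients hR p hsub hτ hpc hBPP (h312 hBPP)
    (U.weakSOI_failure_le hsoi)
  -- Cor. 8.12: decision reduces to search
  exact (hSC.isUniversalHeuristicScheme hR hver).hasUniversalHeuristicScheme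

end Literature.Computability.MetaComplexity
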